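import Summits.BirchSwinnertonDyer.BirchSwinnertonDyer.Theorems.PrintCf2RubinValueTwoKatzMeasureJZeroSeamValuesOfBridgeFamily
import Summits.BirchSwinnertonDyer.BirchSwinnertonDyer.Theorems.PrintCf2RubinValueTwoKatzMeasureJZeroSeamValuesGlue
import Literature.NumberTheory.ComplexMultiplication.EllipticUnits.GrossencharacterGaloisReadings
import Literature.NumberTheory.EllipticCurves.DeShalit1987.FrobeniusTwistReading
import HarnessLib

/-!
# The per-unit VALUES of the `j = 0` seam for ONE reading field, from the bridge identities and ALGEBRAIC readings of the theta datum,
# the complex reading moved by the reading conjugacy `τ` (V1-label-core = V1-core ∘ V1-glue ∘ V1-perm; proofs only)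

Cell `bsd-print-cf2`, width seat `bsd-line-cf2-p1-w8` g13; `--supports` the crux stmt-BirchSwinnertonDyer-20368 (helper, Theses-free).
THEOREMS ONLY; no `def`, no named fact, no `sorry`.

`forall_readingHom_moment_and_frob_eq_of_bridgeFamily_of_readings`: for a finite unramified `E/K_v` and units `β_i ∈ 𝒰_E` with the bridge
identities `g_{β_i} = (G_i ∘ [1]_{P′,f}) ∘ [a]_f` (B10f-e's OUTPUT, `G_i` the `ψ`-read theta product over the representatives `S_i ∖ 0` of `𝔞_i⁻¹L/L`),
the theta datum over `R` read ALGEBRAICALLY — `ι̂(j x₀) = ℘(Ω) − b₂/12`, `ι̂(j (x_i c)) = ℘(c) − b₂/12`, `j(K_i) ∈ K`, `j(τ′ r) = σ̃_v·j(r)` — the reading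
conjugacy `θ ∘ ι̂_v ∘ τ = ι⁻¹ ∘ ι̂_∞` (Q-θ) and an ideal `𝔟` with `τ⁻¹|_{K(𝔣ψ𝔠)} = (𝔟, ·)` together with clause (vii) of II.1.5 at `𝔟`, `v`, `𝔟v`:
**`θ(c_{β_i,k}) = θ(a)^{k+1}·ι⁻¹(−12(#S_i·E_{k+1}(ψ(𝔟)Ω; L) − E_{k+1}(ψ(𝔟)Ω; L_i′)))` and `θ(φ c_{β_i,k}) = (same at ψ(𝔟v)Ω)`** — V1-core
(`forall_map_relCoatesWiles_and_frob_eq_of_bridgeFamily`) with its complex readings through `φ_ℂ = ι̂ ∘ (τ⁻¹ •) ∘ j` discharged by the Galois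
transport (`GrossencharacterGaloisReadings`), the division values re-indexed by the permutation `c ↦ δc` (`δψ𝔟 ≡ 1`), the Frobenius data by
`σ̃_v|_{K(𝔣ψ𝔠)} = (v, ·)`, and `hρ`/`hQθ`/the model transport by `SeamValuesGlue`.  No summit statement is proved; BSD is not proved by any of this.

References: [deShalit1987] II §1.5 (15), II §4.3 (7), II §4.7 (18), II §4.9 (ii), II §4.10 (26), II §4.14 (38) (p. 42–71).
-/

-- the summit namespace `Summit.BirchSwinnertonDyer.BirchSwinnertonDyer` repeats the problem name by design (D-0017)
set_option linter.dupNamespace false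
set_option autoImplicit false

noncomputable section

open scoped Classical
open PowerSeries IsDedekindDomain NumberField ValuativeRel Field PeriodPair
open Literature.NumberTheory.NumberFields Literature.NumberTheory.EllipticCurves Literature.NumberTheory.ComplexMultiplication.EllipticUnits
open Literature.NumberTheory.GaloisRepresentations Literature.NumberTheory.GaloisRepresentations.IsNonarchimedeanLocalField
  Literature.NumberTheory.GaloisRepresentations.LubinTate Literature.NumberTheory.EllipticCurves.FormalGroupChart Literature.NumberTheory.PAdicHodge
open Literature.NumberTheory.LFunctions.AbelianDensity (artinSymbol artinSymbol_asIdeal artinSymbol_mul)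

namespace Summit.BirchSwinnertonDyer.BirchSwinnertonDyer.Theorems.PrintCf2.KatzMeasureJZeroSeam

attribute [local instance] ltNormUniformSpace ltNormIsUniformAddGroup rk1 nF nE fintypeResidueField

variable {K : Type} [Field K] [NumberField K] (v : HeightOneSpectrum (𝓞 K)) [v.asIdeal.LiesOver (ratPlace 2).asIdeal]
  (he : v.asIdeal.ramificationIdx (𝓞 ℚ) = 1) (hf : v.asIdeal.inertiaDeg (𝓞 ℚ) = 1)

/-! ## §1 Small plumbing -/

omit [NumberField K] [v.asIdeal.LiesOver (ratPlace 2).asIdeal] in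
/-- An integer model read in any ring along two composable maps: `(W ⊗ R).map φ = W ⊗ S`. [cite: SilvermanAEC2009, III.1] -/
theorem map_map_intCast {R S : Type*} [CommRing R] [CommRing S] (W : WeierstrassCurve ℤ) (φ : R →+* S) :
    (W.map (Int.castRingHom R)).map φ = W.map (Int.castRingHom S) := by
  rw [WeierstrassCurve.map_map, RingHom.ext_int (φ.comp (Int.castRingHom R)) (Int.castRingHom S)]

omit [NumberField K] in
/-- Two permutations of `S ∖ 0` induced by multiplications (`e₁ c ≡ γ₁c`, `e₂ c ≡ γ₂c (mod Λ)`) COMMUTE on `S ∖ 0` (both composites represent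
`γ₁γ₂c`). [cite: deShalit1987, II §2.3 (10) (p. 42)] -/
theorem perm_comm_of_mul (ι : K →+* ℂ) {L La : PeriodPair} {S : Finset ℂ} (hS : L.IsLatticeReps La S) (hΛ : IsCMLattice ι L.lattice)
    {γ₁ γ₂ : 𝓞 K} {e₁ e₂ : ℂ → ℂ} (h₁S : ∀ c ∈ S.erase 0, e₁ c ∈ S.erase 0) (h₁ : ∀ c ∈ S.erase 0, ι (γ₁ : K) * c - e₁ c ∈ L.lattice)
    (h₂S : ∀ c ∈ S.erase 0, e₂ c ∈ S.erase 0) (h₂ : ∀ c ∈ S.erase 0, ι (γ₂ : K) * c - e₂ c ∈ L.lattice) {c : ℂ} (hc : c ∈ S.erase 0) :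
    e₁ (e₂ c) = e₂ (e₁ c) := by
  have ha := h₁ _ (h₂S c hc)
  have hb := h₂ _ (h₁S c hc)
  have ha' : ι (γ₁ : K) * (ι (γ₂ : K) * c - e₂ c) ∈ L.lattice := hΛ γ₁ _ (h₂ c hc)
  have hb' : ι (γ₂ : K) * (ι (γ₁ : K) * c - e₁ c) ∈ L.lattice := hΛ γ₂ _ (h₁ c hc)
  refine hS.distinct _ (Finset.mem_erase.mp (h₁S _ (h₂S c hc))).2 _ (Finset.mem_erase.mp (h₂S _ (h₁S c hc))).2 ?_
  have e : e₁ (e₂ c) - e₂ (e₁ c) = (ι (γ₂ : K) * (ι (γ₁ : K) * c - e₁ c) + (ι (γ₂ : K) * e₁ c - e₂ (e₁ c))) -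
      (ι (γ₁ : K) * (ι (γ₂ : K) * c - e₂ c) + (ι (γ₁ : K) * e₂ c - e₁ (e₂ c))) := by ring
  rw [e]
  exact L.lattice.sub_mem (L.lattice.add_mem hb' hb) (L.lattice.add_mem ha' ha)

/-! ## §2 The values for one reading field -/

set_option maxHeartbeats 3200000 in
/-- ★★★ **The per-unit values from the bridge identities and ALGEBRAIC readings, complex side moved by `τ`** (see the module docstring).
[cite: deShalit1987, II §1.5 (15) (p. 42), II §4.3 (7) (p. 57), II §4.9 Proposition (ii) (p. 63), II §4.10 (26) (p. 64), II §4.14 (38) (p. 71)] -/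
theorem forall_readingHom_moment_and_frob_eq_of_bridgeFamily_of_readings [IsTotallyComplex K]
    (hq : residueFieldCard (v.adicCompletion K) = 2)
    (h2 : (valuation (v.adicCompletion K)).IsUniformizer ((((2 : ℕ) : 𝒪[v.adicCompletion K]) : v.adicCompletion K)))
    (u : 𝒪[v.adicCompletion K]ˣ)
    (E : IntermediateField (v.adicCompletion K) (AlgebraicClosure (v.adicCompletion K)))
    [FiniteDimensional (v.adicCompletion K) E] [Normal (v.adicCompletion K) E] [IsGalois (v.adicCompletion K) E]
    (hE : E ≤ maxUnramified (v.adicCompletion K))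
    {σ₀ : absoluteGaloisGroup (v.adicCompletion K)} (hσ₀ : IsAbsArithFrob σ₀)
    -- the two readings: `θ : ℂ_{K_v} → ℂ₂` and `ι : ℚ̄₂ ≃ ℂ`, conjugate through `τ ∈ Γ_K` (Q-θ); `w₀ : K → ℂ`
    (θ : CompletedAlgClosure (v.adicCompletion K) →+* ℂ_[2]) (ιp : PadicAlgCl 2 ≃+* ℂ) (w₀ : InfinitePlace K) {τ : absoluteGaloisGroup K}
    (hτ : ∀ x : AlgebraicClosure K,
      θ (algClosureToC (v.adicCompletion K) (absClosureEmbedding K (v.adicCompletion K) (τ • x))) =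
        algebraMap (PadicAlgCl 2) ℂ_[2] (ιp.symm (algClosureEmb w₀.embedding x)))
    -- the `ℤ₂`-datum of the integer model `W` with its Lubin–Tate structure
    (W : WeierstrassCurve ℤ) {c : ℤ_[2]} {P : PowerSeries ℤ_[2]}
    (hP : P.map PadicInt.Coe.ringHom = ((W.map (Int.castRingHom ℤ_[2])).map PadicInt.Coe.ringHom).formalExp.subst
      (C (c : ℚ_[2]) * ((W.map (Int.castRingHom ℤ_[2])).map PadicInt.Coe.ringHom).formalLog))
    {_hA : IsLTRing c 2} (hPlt : IsLTSeries c 2 P)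
    (heπ : ((integerEquivAdicCompletionIntegers v).trans (padicIntEquivOfDegreeOne K 2 v he hf))
      ((u : 𝒪[v.adicCompletion K]) * ((2 : ℕ) : 𝒪[v.adicCompletion K])) = c)
    -- the data ring, read `𝔓`-adically by `ψ` and algebraically by `j` (injective, into `K(𝔣ψ𝔠)`), with `ψ = ι̂_v ∘ j`; its Frobenius `τ′` reads `σ̃_v`
    {R : Type*} [CommRing R] (ψ : R →+* unitBall E) (j : R →+* AlgebraicClosure K) (hjinj : Function.Injective j)
    (hψj : ∀ r : R, ((((ψ r : unitBall E) : E) : AlgebraicClosure (v.adicCompletion K))) = absClosureEmbedding K (v.adicCompletion K) (j r))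
    {𝔣ψ 𝔠 : Ideal (𝓞 K)} (h𝔠0 : 𝔣ψ * 𝔠 ≠ ⊥) (hv𝔠 : ¬ 𝔣ψ * 𝔠 ≤ v.asIdeal) (hjmem : ∀ r : R, j r ∈ rayClassField K (𝔣ψ * 𝔠))
    (τ' : R →+* R) (hτ' : (frobUnitBall E σ₀ : unitBall E →+* unitBall E).comp ψ = ψ.comp τ')
    (hjτ' : ∀ r : R, j (τ' r) = absGaloisRestrict K (v.adicCompletion K) σ₀ • j r)
    -- the model lattice with `𝒪_K`-multiplication, the base point `Ω ∈ 𝔠⁻¹L ∖ L`; per unit: `L′_i = 𝔞_i⁻¹L ⊆ 𝔠⁻¹L` with representatives `S_i`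
    (L : PeriodPair) (hΛ : IsCMLattice w₀.embedding L.lattice)
    (hg₂ : L.g₂ = (W.baseChange ℂ).c₄ / 12) (hg₃ : L.g₃ = (W.baseChange ℂ).c₆ / 216)
    {Ω : ℂ} (hΩ𝔠 : Ω ∈ idealInvLattice w₀.embedding 𝔠 L.lattice) (hΩL : Ω ∉ L.lattice)
    {J : Type*} (𝔞 : J → Ideal (𝓞 K)) (h𝔠𝔞 : ∀ i, 𝔠 ≤ 𝔞 i) (La : J → PeriodPair) (S : J → Finset ℂ)
    (hS : ∀ i, L.IsLatticeReps (La i) (S i)) (hLa : ∀ i, (La i).lattice = idealInvLattice w₀.embedding (𝔞 i) L.lattice)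
    -- the theta datum over `R` with its ALGEBRAIC readings (B10f's shapes), `K_i` rational over `K`
    (x₀ y₀ : R) (Kc : J → R) (KcK : J → K) (x : J → ℂ → R) (uc : J → ℂ → Rˣ) (hu : ∀ i, ∀ c ∈ (S i).erase 0, (uc i c : R) = x₀ - x i c)
    (hKc : ∀ i, j (Kc i) = algebraMap K (AlgebraicClosure K) (KcK i))
    (hKj : ∀ i, algClosureEmb w₀.embedding (j (Kc i)) = L.deltaRatio (La i) * (L.g₂ ^ 3 - 27 * L.g₃ ^ 2) ^ ((S i).card - 1))
    (hxj : ∀ i, ∀ c ∈ (S i).erase 0, algClosureEmb w₀.embedding (j (x i c)) = ℘[L] c - (W.baseChange ℂ).b₂ / 12)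
    (hx₀ : algClosureEmb w₀.embedding (j x₀) = ℘[L] Ω - (W.baseChange ℂ).b₂ / 12)
    (hy₀ : algClosureEmb w₀.embedding (j y₀) = (℘'[L] Ω - (W.baseChange ℂ).a₁ * (℘[L] Ω - (W.baseChange ℂ).b₂ / 12) - (W.baseChange ℂ).a₃) / 2)
    -- the units and their bridge identities with ONE Tate unit `a` (B10f-e's conclusion shape)
    (β : J → RelNormCoherentUnits (isUniformizer_unit_mul h2 u) E) (a : 𝒪[v.adicCompletion K]ˣ)
    (hβ : ∀ i, relColemanSeries (isUniformizer_unit_mul h2 u) E hq hE hσ₀ (β i) =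
      PowerSeries.subst ((hom (isLTRing_LTCoeff (isUniformizer_unit_mul h2 u)) (isLTSeries_LTCoeff _) (isLTSeries_LTCoeff _)
          (LTCoeff.of (v.adicCompletion K) (a : 𝒪[v.adicCompletion K]))).map (algebraMap (LTCoeff (v.adicCompletion K)) (unitBall E)))
        (PowerSeries.subst ((hom (isLTRing_LTCoeff (isUniformizer_unit_mul h2 u))
            (isLTSeries_map_LTCoeff_of_degree_one ((integerEquivAdicCompletionIntegers v).trans (padicIntEquivOfDegreeOne K 2 v he hf)) hq heπ hPlt)
            (isLTSeries_LTCoeff _) 1).map (algebraMap (LTCoeff (v.adicCompletion K)) (unitBall E)))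
          (PowerSeries.map ψ (C (Kc i) * ∏ c ∈ (S i).erase 0,
            PowerSeries.invOfUnit (((W.map (Int.castRingHom R)).translateX x₀ y₀).subst (W.map (Int.castRingHom R)).formalNeg - C (x i c))
              (uc i c) ^ 6))))
    -- clause (vi) of II.1.5 at `(𝔣ψ, 𝔠)`, an ideal `𝔟` with `τ⁻¹|_{K(𝔣ψ𝔠)} = (𝔟, ·)`, clause (vii) at `𝔟`, at `v`, at `𝔟v`; inverses `δ` of `ψ𝔟` and `β_K` of `ψ v` modulo `𝔠`
    (ψK : Ideal (𝓞 K) → 𝓞 K) {𝔟 : Ideal (𝓞 K)} (h𝔟0 : 𝔟 ≠ ⊥)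
    (hvi : ∀ z : ℂ, z ∈ idealInvLattice w₀.embedding 𝔠 L.lattice → z ∉ L.lattice →
      ∃ x y : rayClassField K (𝔣ψ * 𝔠), algClosureEmb w₀.embedding x = ℘[L] z ∧ algClosureEmb w₀.embedding y = ℘'[L] z)
    (hg : absRestrictNormalHom (rayClassField K (𝔣ψ * 𝔠)) τ⁻¹ = artinSymbol (galFrob K (rayClassField K (𝔣ψ * 𝔠))) 𝔟)
    (hvii : ∀ 𝔟' ∈ ({𝔟, v.asIdeal, 𝔟 * v.asIdeal} : Set (Ideal (𝓞 K))), ∀ z : ℂ, z ∈ idealInvLattice w₀.embedding 𝔠 L.lattice → z ∉ L.lattice →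
      ∀ x y : rayClassField K (𝔣ψ * 𝔠), algClosureEmb w₀.embedding x = ℘[L] z → algClosureEmb w₀.embedding y = ℘'[L] z →
        algClosureEmb w₀.embedding (artinSymbol (galFrob K (rayClassField K (𝔣ψ * 𝔠))) 𝔟' x) = ℘[L] (w₀.embedding (ψK 𝔟' : K) * z) ∧
        algClosureEmb w₀.embedding (artinSymbol (galFrob K (rayClassField K (𝔣ψ * 𝔠))) 𝔟' y) = ℘'[L] (w₀.embedding (ψK 𝔟' : K) * z))
    {δ βK : 𝓞 K} (hδ : δ * ψK 𝔟 - 1 ∈ 𝔠) (hβK : βK * ψK v.asIdeal - 1 ∈ 𝔠)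
    (hΩb : ∀ i, w₀.embedding (ψK 𝔟 : K) * Ω ∉ (La i).lattice) (hΩb' : ∀ i, w₀.embedding (ψK (𝔟 * v.asIdeal) : K) * Ω ∉ (La i).lattice) :
    ∀ (i : J) (k : ℕ),
      (θ.comp ((CBall (v.adicCompletion K)).subtype.comp (unitBallToCBall E)))
          (PowerSeries.constantCoeff ((fun g : PowerSeries (unitBall E) =>
            (invDiff (isLTRing_LTCoeff (isUniformizer_unit_mul h2 u))
                (isLTSeries_LTCoeff ((u : 𝒪[v.adicCompletion K]) * ((2 : ℕ) : 𝒪[v.adicCompletion K])))).map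
                (algebraMap (LTCoeff (v.adicCompletion K)) (unitBall E)) *
              PowerSeries.derivative (unitBall E) g)^[k] (relLogDerivSeries (isUniformizer_unit_mul h2 u) E hq hE hσ₀ (β i)))) =
        (θ (algebraMap (v.adicCompletion K) (CompletedAlgClosure (v.adicCompletion K)) ((a : 𝒪[v.adicCompletion K]) : v.adicCompletion K))) ^ (k + 1) *
          ((ιp.symm (-12 * (((S i).card : ℂ) * L.eisensteinE (k + 1) (w₀.embedding (ψK 𝔟 : K) * Ω) -
            (La i).eisensteinE (k + 1) (w₀.embedding (ψK 𝔟 : K) * Ω))) : PadicAlgCl 2) : ℂ_[2]) ∧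
      (θ.comp ((CBall (v.adicCompletion K)).subtype.comp (unitBallToCBall E)))
          ((frobUnitBall E σ₀ : unitBall E →+* unitBall E) (PowerSeries.constantCoeff ((fun g : PowerSeries (unitBall E) =>
            (invDiff (isLTRing_LTCoeff (isUniformizer_unit_mul h2 u))
                (isLTSeries_LTCoeff ((u : 𝒪[v.adicCompletion K]) * ((2 : ℕ) : 𝒪[v.adicCompletion K])))).map
                (algebraMap (LTCoeff (v.adicCompletion K)) (unitBall E)) *
              PowerSeries.derivative (unitBall E) g)^[k] (relLogDerivSeries (isUniformizer_unit_mul h2 u) E hq hE hσ₀ (β i))))) =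
        (θ (algebraMap (v.adicCompletion K) (CompletedAlgClosure (v.adicCompletion K)) ((a : 𝒪[v.adicCompletion K]) : v.adicCompletion K))) ^ (k + 1) *
          ((ιp.symm (-12 * (((S i).card : ℂ) * L.eisensteinE (k + 1) (w₀.embedding (ψK (𝔟 * v.asIdeal) : K) * Ω) -
            (La i).eisensteinE (k + 1) (w₀.embedding (ψK (𝔟 * v.asIdeal) : K) * Ω))) : PadicAlgCl 2) : ℂ_[2]) := by
  -- notation
  set ι : K →+* ℂ := w₀.embedding with hιdef
  set φC : R →+* ℂ := (algClosureEmb ι).comp ((MulSemiringAction.toRingHom (absoluteGaloisGroup K) (AlgebraicClosure K) τ⁻¹).comp j)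
    with hφCdef
  have hφC : ∀ r : R, φC r = algClosureEmb ι (τ⁻¹ • j r) := fun r ↦ by
    simp only [hφCdef, RingHom.comp_apply, MulSemiringAction.toRingHom_apply]
  have hb₂ : (W.baseChange ℂ).b₂ = (W.b₂ : ℂ) := by simp [WeierstrassCurve.baseChange, WeierstrassCurve.map_b₂]
  have ha₁ : (W.baseChange ℂ).a₁ = (W.a₁ : ℂ) := by simp [WeierstrassCurve.baseChange]
  have ha₃ : (W.baseChange ℂ).a₃ = (W.a₃ : ℂ) := by simp [WeierstrassCurve.baseChange]
  -- the restrictions to `K(𝔣ψ𝔠)`: `σ̃_v ↦ (v, ·)`, `τ⁻¹σ̃_v ↦ (𝔟v, ·)`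
  have hgv : absRestrictNormalHom (rayClassField K (𝔣ψ * 𝔠)) (absGaloisRestrict K (v.adicCompletion K) σ₀) =
      artinSymbol (galFrob K (rayClassField K (𝔣ψ * 𝔠))) v.asIdeal := by
    rw [absRestrictNormalHom_rayClassField_absGaloisRestrict_eq_galFrob h𝔠0 hv𝔠 hσ₀, artinSymbol_asIdeal]
  have hgbv : absRestrictNormalHom (rayClassField K (𝔣ψ * 𝔠)) (τ⁻¹ * absGaloisRestrict K (v.adicCompletion K) σ₀) =
      artinSymbol (galFrob K (rayClassField K (𝔣ψ * 𝔠))) (𝔟 * v.asIdeal) := by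
    rw [map_mul, hg, hgv, artinSymbol_mul _ h𝔟0 v.ne_bot]
  have hvii𝔟 := hvii 𝔟 (by simp)
  have hviiv := hvii v.asIdeal (by simp)
  have hviibv := hvii (𝔟 * v.asIdeal) (by simp)
  -- lattice bookkeeping: `L′_i ⊆ 𝔠⁻¹L`, `𝒪_K`-stability of `L′_i`, the representatives lie in `𝔠⁻¹L ∖ L`
  have hLa𝔠 : ∀ i, (La i).lattice ≤ idealInvLattice ι 𝔠 L.lattice := fun i z hz ↦ by
    rw [hLa i] at hz
    exact mem_idealInvLattice_iff.mpr fun t ht ↦ mem_idealInvLattice_iff.mp hz t (h𝔠𝔞 i ht)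
  have hΛa : ∀ i, IsCMLattice ι (La i).lattice := fun i t z hz ↦ by
    rw [hLa i] at hz ⊢; exact mul_mem_idealInvLattice ι hΛ t hz
  have hrepL : ∀ i, ∀ c ∈ (S i).erase 0, c ∈ idealInvLattice ι 𝔠 L.lattice ∧ c ∉ L.lattice := fun i c hc ↦ by
    obtain ⟨hc0, hcS⟩ := Finset.mem_erase.mp hc
    exact ⟨hLa𝔠 i (rep_mem (hS i) hcS), fun h ↦ hc0 ((hS i).distinct c hcS 0 (hS i).zero_mem (by rwa [sub_zero]))⟩
  -- `δψ𝔟 ≡ 1` and `β_Kψv ≡ 1` on every `L′_i/L`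
  have hδ' : ∀ i, ∀ z ∈ (La i).lattice, ι ((δ * ψK 𝔟 : 𝓞 K) : K) * z - z ∈ L.lattice := fun i z hz ↦ by
    have h1 : ι ((δ * ψK 𝔟 - 1 : 𝓞 K) : K) * z ∈ L.lattice := by
      rw [hLa i] at hz; exact mem_idealInvLattice_iff.mp hz _ (h𝔠𝔞 i hδ)
    have e : ι ((δ * ψK 𝔟 : 𝓞 K) : K) * z - z = ι ((δ * ψK 𝔟 - 1 : 𝓞 K) : K) * z := by push_cast; rw [map_sub, map_one]; ring
    rwa [e]
  have hβK' : ∀ i, ∀ z ∈ (La i).lattice, ι ((ψK v.asIdeal * βK : 𝓞 K) : K) * z - z ∈ L.lattice := fun i z hz ↦ by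
    have h1 : ι ((βK * ψK v.asIdeal - 1 : 𝓞 K) : K) * z ∈ L.lattice := by
      rw [hLa i] at hz; exact mem_idealInvLattice_iff.mp hz _ (h𝔠𝔞 i hβK)
    have e : ι ((ψK v.asIdeal * βK : 𝓞 K) : K) * z - z = ι ((βK * ψK v.asIdeal - 1 : 𝓞 K) : K) * z := by
      push_cast; rw [map_sub, map_one, map_mul, map_mul]; ring
    rwa [e]
  -- model `y`-coordinates of the division values from clause (vi)
  have hY : ∀ i, ∀ c ∈ (S i).erase 0, ∃ Y : AlgebraicClosure K, Y ∈ rayClassField K (𝔣ψ * 𝔠) ∧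
      algClosureEmb ι Y = (℘'[L] c - (W.baseChange ℂ).a₁ * (℘[L] c - (W.baseChange ℂ).b₂ / 12) - (W.baseChange ℂ).a₃) / 2 := by
    intro i c hc
    obtain ⟨hc1, hc2⟩ := hrepL i c hc
    obtain ⟨xa, ya, hxa, hya⟩ := hvi c hc1 hc2
    refine ⟨((ya : AlgebraicClosure K) - (W.a₁ : AlgebraicClosure K) * ((xa : AlgebraicClosure K) - (W.b₂ : AlgebraicClosure K) / 12) -
        (W.a₃ : AlgebraicClosure K)) / 2, ?_, ?_⟩
    · exact div_mem (sub_mem (sub_mem ya.2 (mul_mem (intCast_mem _ _) (sub_mem xa.2 (div_mem (intCast_mem _ _) (ofNat_mem _ 12)))))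
        (intCast_mem _ _)) (ofNat_mem _ 2)
    · rw [map_div₀, map_sub, map_sub, map_mul, map_sub, map_div₀, map_intCast, map_intCast, map_intCast, map_ofNat, map_ofNat, hxa, hya,
        hb₂, ha₁, ha₃]
  choose! Y hYm hYv using hY
  -- the permutation `e_δ` (for `τ⁻¹`, multiplier `ψ𝔟`) and the re-indexed division values `x′ = x ∘ e_δ`
  have hperm : ∀ i, ∃ e : ℂ → ℂ, (∀ c ∈ (S i).erase 0, e c ∈ (S i).erase 0) ∧ (∀ c ∈ (S i).erase 0, ι (δ : K) * c - e c ∈ L.lattice) ∧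
      Set.InjOn e ((S i).erase 0 : Finset ℂ) ∧ Set.SurjOn e ((S i).erase 0 : Finset ℂ) ((S i).erase 0 : Finset ℂ) ∧
      ∀ c ∈ (S i).erase 0, algClosureEmb ι (τ⁻¹ • j (x i (e c))) = ℘[L] c - (W.baseChange ℂ).b₂ / 12 := fun i ↦
    exists_perm_readings_of_absRestrictNormalHom_eq ι W (hS i) hΛ (hΛa i) (hLa𝔠 i) hvii𝔟 hg (hδ' i) (fun c ↦ j (x i c)) (Y i)
      (fun c _ ↦ hjmem _) (hYm i) (hxj i) (hYv i)
  choose eδ heδS heδ heδinj heδsurj hxeδ using hperm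
  -- the permutation `e_v` (for `σ̃_v`, multiplier `ψ v`)
  have hpermv : ∀ i, ∃ e : ℂ → ℂ, (∀ c ∈ (S i).erase 0, e c ∈ (S i).erase 0) ∧
      (∀ c ∈ (S i).erase 0, ι (ψK v.asIdeal : K) * c - e c ∈ L.lattice) ∧
      Set.InjOn e ((S i).erase 0 : Finset ℂ) ∧ Set.SurjOn e ((S i).erase 0 : Finset ℂ) ((S i).erase 0 : Finset ℂ) := fun i ↦
    exists_perm_of_mul_inv ι (hS i) hΛ (hΛa i) (hβK' i)
  choose ev hevS hev hevinj hevsurj using hpermv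
  -- `τ′` permutes the division values by `e_v`: `τ′(x_i c) = x_i(e_v c)` (readings through the injective `ι̂ ∘ j`)
  have hxτv : ∀ i, ∀ c ∈ (S i).erase 0, τ' (x i c) = x i (ev i c) := by
    intro i
    refine apply_eq_of_readings ι (fun r ↦ algClosureEmb ι (j r)) ((algClosureEmb ι).injective.comp hjinj) τ' (x i)
      ((W.baseChange ℂ).b₂ / 12) (hevS i) (hev i) (hxj i) fun c hc ↦ ?_
    obtain ⟨hc1, hc2⟩ := hrepL i c hc
    rw [hjτ']
    exact (algClosureEmb_smul_model_eq_of_absRestrictNormalHom_eq ι W hviiv hgv hc1 hc2 (hjmem _) (hYm i c hc) (hxj i c hc) (hYv i c hc)).1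
  -- the data for V1-core
  set x' : J → ℂ → R := fun i c' ↦ x i (eδ i c') with hx'def
  set uc' : J → ℂ → Rˣ := fun i c' ↦ uc i (eδ i c') with huc'def
  have hu' : ∀ i, ∀ c' ∈ (S i).erase 0, (uc' i c' : R) = x₀ - x' i c' := fun i c' hc' ↦ hu i _ (heδS i c' hc')
  have hprod : ∀ i, (∏ c' ∈ (S i).erase 0,
      PowerSeries.invOfUnit (((W.map (Int.castRingHom R)).translateX x₀ y₀).subst (W.map (Int.castRingHom R)).formalNeg - C (x' i c')) (uc' i c') ^ 6) =
      ∏ c' ∈ (S i).erase 0,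
      PowerSeries.invOfUnit (((W.map (Int.castRingHom R)).translateX x₀ y₀).subst (W.map (Int.castRingHom R)).formalNeg - C (x i c')) (uc i c') ^ 6 :=
    fun i ↦ Finset.prod_nbij (eδ i) (fun c' hc' ↦ heδS i c' hc') (heδinj i) (heδsurj i) (fun _ _ ↦ rfl)
  obtain ⟨G, hG⟩ : ∃ G : J → PowerSeries (unitBall E), ∀ i, G i = PowerSeries.map ψ (C (Kc i) * ∏ c' ∈ (S i).erase 0,
      PowerSeries.invOfUnit (((W.map (Int.castRingHom R)).translateX x₀ y₀).subst (W.map (Int.castRingHom R)).formalNeg - C (x' i c')) (uc' i c') ^ 6) :=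
    ⟨_, fun _ ↦ rfl⟩
  have hβ' : ∀ i, relColemanSeries (isUniformizer_unit_mul h2 u) E hq hE hσ₀ (β i) =
      PowerSeries.subst ((hom (isLTRing_LTCoeff (isUniformizer_unit_mul h2 u)) (isLTSeries_LTCoeff _) (isLTSeries_LTCoeff _)
          (LTCoeff.of (v.adicCompletion K) (a : 𝒪[v.adicCompletion K]))).map (algebraMap (LTCoeff (v.adicCompletion K)) (unitBall E)))
        (PowerSeries.subst ((hom (isLTRing_LTCoeff (isUniformizer_unit_mul h2 u))
            (isLTSeries_map_LTCoeff_of_degree_one ((integerEquivAdicCompletionIntegers v).trans (padicIntEquivOfDegreeOne K 2 v he hf)) hq heπ hPlt)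
            (isLTSeries_LTCoeff _) 1).map (algebraMap (LTCoeff (v.adicCompletion K)) (unitBall E))) (G i)) := fun i ↦ by
    rw [hG i, hprod i]; exact hβ i
  -- complex readings through `φ_ℂ`
  have hV : (W.map (Int.castRingHom R)).map φC = W.baseChange ℂ := by
    rw [map_map_intCast]; rfl
  have haC : φC x₀ = ℘[L] (ι (ψK 𝔟 : K) * Ω) - (W.baseChange ℂ).b₂ / 12 ∧
      φC y₀ = (℘'[L] (ι (ψK 𝔟 : K) * Ω) - (W.baseChange ℂ).a₁ * (℘[L] (ι (ψK 𝔟 : K) * Ω) - (W.baseChange ℂ).b₂ / 12) - (W.baseChange ℂ).a₃) / 2 := by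
    rw [hφC, hφC]
    exact algClosureEmb_smul_model_eq_of_absRestrictNormalHom_eq ι W hvii𝔟 hg hΩ𝔠 hΩL (hjmem _) (hjmem _) hx₀ hy₀
  have haC' : φC (τ' x₀) = ℘[L] (ι (ψK (𝔟 * v.asIdeal) : K) * Ω) - (W.baseChange ℂ).b₂ / 12 ∧
      φC (τ' y₀) = (℘'[L] (ι (ψK (𝔟 * v.asIdeal) : K) * Ω) -
        (W.baseChange ℂ).a₁ * (℘[L] (ι (ψK (𝔟 * v.asIdeal) : K) * Ω) - (W.baseChange ℂ).b₂ / 12) - (W.baseChange ℂ).a₃) / 2 := by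
    rw [hφC, hφC, hjτ', hjτ', smul_smul, smul_smul]
    exact algClosureEmb_smul_model_eq_of_absRestrictNormalHom_eq ι W hviibv hgbv hΩ𝔠 hΩL (hjmem _) (hjmem _) hx₀ hy₀
  have hK : ∀ i, φC (Kc i) = L.deltaRatio (La i) * (L.g₂ ^ 3 - 27 * L.g₃ ^ 2) ^ ((S i).card - 1) := fun i ↦ by
    rw [hφC, hKc, smul_algebraMap, ← hKc, hKj]
  have hx' : ∀ i, ∀ c' ∈ (S i).erase 0, φC (x' i c') = ℘[L] c' - (W.baseChange ℂ).b₂ / 12 := fun i c' hc' ↦ by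
    rw [hφC]; exact hxeδ i c' hc'
  -- Frobenius data
  have hWτ' : (W.map (Int.castRingHom R)).map τ' = W.map (Int.castRingHom R) := map_map_intCast W τ'
  have hKτ' : ∀ i, τ' (Kc i) = Kc i := fun i ↦ hjinj (by rw [hjτ', hKc, smul_algebraMap])
  have hxτ' : ∀ i, ∀ c' ∈ (S i).erase 0, τ' (x' i c') = x' i (ev i c') := fun i c' hc' ↦ by
    show τ' (x i (eδ i c')) = x i (eδ i (ev i c'))
    rw [hxτv i _ (heδS i c' hc'), perm_comm_of_mul ι (hS i) hΛ (hevS i) (hev i) (heδS i) (heδ i) hc']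
  -- the two readings `hρ`, `hQθ`, and the model over `ℂ₂` two ways
  have hρ := readingHom_comp_algebraMap_LTCoeff θ E
  have hQθ : (θ.comp ((CBall (v.adicCompletion K)).subtype.comp (unitBallToCBall E))).comp ψ =
      ((algebraMap (PadicAlgCl 2) ℂ_[2]).comp ιp.symm.toRingHom).comp φC :=
    readingHom_comp_eq_of_reading_conj θ E ιp w₀ hτ ψ j hψj
  have hW' : ((W.map (Int.castRingHom R)).map φC).map ((algebraMap (PadicAlgCl 2) ℂ_[2]).comp ιp.symm.toRingHom) =
      ((W.map (Int.castRingHom ℤ_[2])).map (((padicEquivOfDegreeOne K 2 v he hf).symm.toRingHom).comp (PadicInt.Coe.ringHom (p := 2)))).map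
        (θ.comp (algebraMap (v.adicCompletion K) (CompletedAlgClosure (v.adicCompletion K)))) := by
    rw [map_map_intCast, map_map_intCast, map_map_intCast, map_map_intCast]
  -- V1-core
  intro i k
  exact forall_map_relCoatesWiles_and_frob_eq_of_bridgeFamily (_hA := _hA) K v he hf hq h2 u E hE hσ₀
    (θ.comp ((CBall (v.adicCompletion K)).subtype.comp (unitBallToCBall E)))
    (θ.comp (algebraMap (v.adicCompletion K) (CompletedAlgClosure (v.adicCompletion K)))) hρ ιp (W.map (Int.castRingHom ℤ_[2])) hP hPlt heπ
    ψ (W.map (Int.castRingHom R)) x₀ y₀ φC (W.baseChange ℂ) L (ι (ψK 𝔟 : K) * Ω) hg₂ hg₃ hV haC.1 haC.2 hQθ hW' β G La S hS hΩb Kc x' uc'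
    hK hx' hu' hG a hβ' τ' hτ' hWτ' hKτ' ev hevS hevinj hevsurj hxτ' (ι (ψK (𝔟 * v.asIdeal) : K) * Ω) hΩb' haC'.1 haC'.2 i k

end Summit.BirchSwinnertonDyer.BirchSwinnertonDyer.Theorems.PrintCf2.KatzMeasureJZeroSeam

end
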